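import Summits.BirchSwinnertonDyer.BirchSwinnertonDyer.Theorems.ResidualThetaTransportAtTwoResidualSignedLambdaLowerCMAtTwoRhoLayerPairingTower
import Summits.BirchSwinnertonDyer.BirchSwinnertonDyer.Theorems.ThetaPartnerAtTwoSignedKatoUpToAtTwoLayerPairingModDefs
import Literature.NumberTheory.EllipticCurves.Kato2004.IwasawaH1Reduction
import Literature.NumberTheory.EllipticCurves.Kato2004.IwasawaCohomologyCoeff
import Literature.NumberTheory.GaloisRepresentations.ContinuousShapiroLiftCores
import Literature.NumberTheory.GaloisRepresentations.ContinuousShapiroLiftPairing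
import Literature.NumberTheory.EllipticCurves.Sprung2012.LocalIwasawaModule
import HarnessLib

/-!
# K-c: the PROJECTION FORMULA (P1) across layers for the `ρ`-coefficient layer Tate pairings, and the glue
# `locd₂ : 𝐇¹_Γ(T_ρ) →+ Hom((Fin r → E(ℚ_{∞,v})), ℤ_p)` of the pinned family over the tower

Route `ResidualThetaTransportAtTwo` (RTT), crux RSL_g `ResidualSignedLambdaLowerCMAtTwo` (stmt-BirchSwinnertonDyer-22608); seat `prover-bsd-wall-rtt-p2` g17
(`--supports`, closes nothing). THEOREMS ONLY (no definition, no named fact, no instance, no `sorry`). BSD is not proved by any of this; RSL_g is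
not proved here. Item K-c of `Cruxes/ResidualThetaCountLowerPureAtTwo/SKELETON-V2-CUT-g16.md` §3 (currency (C3): `locd₂` VALUE-PINNED by
`locd₂ x Q = rhoLayerPairingAdic … n (hcompat n) (I.proj n x) Q` on layer points).

WHAT (the `ρ`/generic-coefficient twin of TP2's `layerPairingMod_layerCores` / `layerPairingPk_layerCores` / `ColGlue.exists_col`).
* §1 generic coefficient module `M`: `layerLocOf_layerCores` (localisation carries Kato's trace to the local corestriction — the tree's unconditional
  `LocalCores.map_resGalSubgroupOfEmb_layerCores_cyclotomic`), **`layerPairingOf_layerCores`**: `⟨loc_n(cor x), y⟩_{n,N} = ⟨loc_{n+1} x, res y⟩_{n+1,N}`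
  (Shapiro: `cohomologyMap_coindFinSum_shapiroLift`, `ContPairing.cupProduct_coindFinSum_left`, `cohomologyMap_coindFinRes_shapiroLift`).
* §2 `ρ`: `reduceH1CofreePkTorsion_layerCores` (`red_{p^k} ∘ cor = cor ∘ red_{p^k}`, `mapH1AddHom_coresLe`), `resLe_thetaSingleH1`,
  `resLe_thetaLayerKummer` (`res_{U_{n+1}}^{U_n}` of the Θ-Kummer class of `Q ∈ E(ℚ_{n,v})^r` is its Θ-Kummer class at layer `n+1`),
  **`rhoLayerPairingPk_layerCores`** ((P1) modulo `p^k`) and **`rhoLayerPairingAdic_layerCores`** ((P1) for THE pinned `ℤ_p`-valued family).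
* §3 **`exists_locd₂_of_layerCores`**: for a pinned datum `I : IwasawaH1DataCoeff ρ.toGaloisRep p κ γ` (Kato's `𝐇¹_Γ(T_ρ)`) and ANY family
  `pair n : H¹(Γ_n, T_ρ) →+ ((Fin r → E(ℚ_{n,v})) →+ ℤ_p)` with (P1): ONE additive `locd₂ : I.H →+ ((Fin r → E(ℚ_{∞,v})) →+ ℤ_p)` with the layer formula
  `locd₂ x Q = pair n (I.proj n x) Q` whenever every `Q_i ∈ E(ℚ_{n,v})` (common layer by `Sprung2012.level`; level-independence by (P1) + `I.cores_proj`),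
  and its uniqueness `locd₂_unique`.

References: [Kobayashi2003] (8.23) (p. 18); [PerrinRiou1994Invent] §3.6.1; [Kato2004Asterisque] §12.2 (p. 220), §13.8 (pp. 228–229), §17.13;
[NeukirchSchmidtWingberg2008] I §5 Prop. (1.5.3)(iv), (1.5.6)–(1.5.7); [Sprung2012] Lemma 7.10.
-/

set_option autoImplicit false
-- the Theorems namespace of this sub repeats the summit name by design (D-0017 nested layout)
set_option linter.dupNamespace false

noncomputable section

open scoped Classical

namespace Summit.BirchSwinnertonDyer.BirchSwinnertonDyer.Theorems.ThetaTransport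

open CategoryTheory Field NumberField IsDedekindDomain WeierstrassCurve
  Literature.NumberTheory.EllipticCurves Literature.NumberTheory.GaloisRepresentations
  Literature.NumberTheory.EllipticCurves.Kobayashi2003 Literature.NumberTheory.EllipticCurves.Sprung2012
  Literature.NumberTheory.EllipticCurves.GreenbergSelmer Literature.NumberTheory.EllipticCurves.CyclotomicLayer
  Literature.NumberTheory.EllipticCurves.Kato2004
  Literature.NumberTheory.GaloisCohomology ZpExtension

attribute [local instance] absoluteGaloisGroup_compactSpace

/-! ## §1 Generic coefficients: `⟨loc_n(cor x), y⟩_n = ⟨loc_{n+1} x, res y⟩_{n+1}` -/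

section Generic

variable {p : ℕ} [Fact p.Prime] {M : Type} [AddCommGroup M] [TopologicalSpace M] [DiscreteTopology M]
  (ρM : DiscreteGaloisModule ℚ M) (N : ℕ) [NeZero N]
  (e : M → M → AlgebraicClosure ℚ)
  (hμ : ∀ S T, e S T ^ N = 1)
  (hadd₁ : ∀ S₁ S₂ T, e (S₁ + S₂) T = e S₁ T * e S₂ T)
  (hadd₂ : ∀ S T₁ T₂, e S (T₁ + T₂) = e S T₁ * e S T₂)
  (hgal : ∀ (σ : absoluteGaloisGroup ℚ) (S T : M), σ • e S T = e (ρM σ S) (ρM σ T))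
  (κ : ZpExtension ℚ p) (v : HeightOneSpectrum (𝓞 ℚ)) (hκ : κ.IsCyclotomic) (hv : (p : 𝓞 ℚ) ∈ v.asIdeal)

include hκ hv in
omit [NeZero N] in
/-- **Localisation carries Kato's trace map to the local corestriction** (generic coefficient module, Literature dialect `layerLocOf`):
`loc_n (layerCores y) = cor_{U_{n+1} → U_n} (loc_{n+1} y)` — the tree's unconditional `LocalCores.map_resGalSubgroupOfEmb_layerCores_cyclotomic`.
[cite: Kato2004Asterisque, §12.2 (p. 220)] [cite: NeukirchSchmidtWingberg2008, I §5 Prop. (1.5.6)–(1.5.7)] -/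
theorem layerLocOf_layerCores (n : ℕ)
    [Fintype (layerGroup κ v n ⧸ (layerGroup κ v (n + 1)).subgroupOf (layerGroup κ v n))]
    (y : H1 ρM (κ.layerSubgroup (n + 1))) :
    layerLocOf ρM κ v n (layerCores ρM κ n y) =
      coresLe (localRepOf ρM v) (SignedKatoOffTwo.LayerPairing.layerGroup_antitone κ v n) (isOpen_layerGroup κ v (n + 1))
        (layerLocOf ρM κ v (n + 1) y) :=
  SignedKatoOffTwo.LocalCores.map_resGalSubgroupOfEmb_layerCores_cyclotomic κ hκ v hv ρM n y

omit [NeZero N] [Fact p.Prime] in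
/-- `H²(𝟙) = id` on `H²(Γ_v, μ_N|)` (Literature dialect). [cite: NeukirchSchmidtWingberg2008, I §5] -/
theorem cohomologyMap_id_muLocalRep' (c : continuousCohomology 2 (muLocalRep N v)) :
    cohomologyMap (𝟙 (muLocalRep N v)) 2 c = c := by
  rw [show cohomologyMap (𝟙 (muLocalRep N v)) 2 = 𝟙 _ from map_id_eq_id _ (fun _ => rfl) 2]
  rfl

include hκ hv in
/-- **(P1) modulo `N`, generic coefficients — the projection formula across layers**: for `x ∈ H¹(Γ_{n+1}, M)` and a local class
`y ∈ H¹(U_n, M|)`, `⟨loc_n(cor x), y⟩_{n,N} = ⟨loc_{n+1} x, res_{U_{n+1}}^{U_n} y⟩_{n+1,N}`. Assembly as in TP2's `layerPairingMod_layerCores`: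
`layerLocOf_layerCores`; Shapiro carries the local `cor` to the fibre sum (`cohomologyMap_coindFinSum_shapiroLift`); the fibre sum in the first
slot is adjoint to the pull-back in the second (`ContPairing.cupProduct_coindFinSum_left`); Shapiro carries the pull-back to `res`
(`cohomologyMap_coindFinRes_shapiroLift`). [cite: Kobayashi2003, (8.23) (p. 18)] [cite: PerrinRiou1994Invent, §3.6.1]
[cite: NeukirchSchmidtWingberg2008, I §5 Prop. (1.5.3)(iv)] -/
theorem layerPairingOf_layerCores (n : ℕ) (x : H1 ρM (κ.layerSubgroup (n + 1)))
    (y : continuousCohomology 1 (subgroupRep (localRepOf ρM v) (layerGroup κ v n))) :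
    layerPairingOf ρM N e hμ hadd₁ hadd₂ hgal κ v n (layerCores ρM κ n x) y =
      layerPairingOf ρM N e hμ hadd₁ hadd₂ hgal κ v (n + 1) x
        (resLe (localRepOf ρM v) (SignedKatoOffTwo.LayerPairing.layerGroup_antitone κ v n) 1 y) := by
  letI : Fintype (absoluteGaloisGroup (v.adicCompletion ℚ) ⧸ layerGroup κ v n) := layerFintypeQuot κ v n
  letI : Fintype (absoluteGaloisGroup (v.adicCompletion ℚ) ⧸ layerGroup κ v (n + 1)) := layerFintypeQuot κ v (n + 1)
  haveI : (layerGroup κ v (n + 1)).FiniteIndex := finiteIndex_of_isOpen_of_compactSpace _ (isOpen_layerGroup κ v (n + 1))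
  haveI : Fintype (layerGroup κ v n ⧸ (layerGroup κ v (n + 1)).subgroupOf (layerGroup κ v n)) := Fintype.ofFinite _
  rw [layerPairingOf_apply, layerPairingOf_apply, layerPairingH1Of_apply, layerPairingH1Of_apply,
    layerLocOf_layerCores ρM κ v hκ hv n x]
  unfold layerShapiroOf layerSumPairingOf
  rw [← cohomologyMap_coindFinSum_shapiroLift (localRepOf ρM v) (SignedKatoOffTwo.LayerPairing.layerGroup_antitone κ v n)
      (isOpen_layerGroup κ v n) (isOpen_layerGroup κ v (n + 1)) (layerReps_spec κ v n) (layerReps_one κ v n) (layerReps_spec κ v (n + 1))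
      (layerReps_one κ v (n + 1)),
    ← cohomologyMap_id_muLocalRep' N v (ContPairing.cupProduct _ _ _),
    ContPairing.cupProduct_coindFinSum_left,
    cohomologyMap_coindFinRes_shapiroLift (localRepOf ρM v) (SignedKatoOffTwo.LayerPairing.layerGroup_antitone κ v n)
      (isOpen_layerGroup κ v n) (isOpen_layerGroup κ v (n + 1)) (layerReps_spec κ v n) (layerReps_one κ v n) (layerReps_spec κ v (n + 1))
      (layerReps_one κ v (n + 1))]

end Generic

/-! ## §2 `ρ`: reduction, Θ-Kummer restriction, and (P1) for `rhoLayerPairingPk` / `rhoLayerPairingAdic` -/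

section Rho

variable {p : ℕ} [Fact p.Prime] (S : Set (PadicAlgCl p)) {d : ℕ} (ρ : FramedGaloisRep ℚ ↥(padicCoeffIntegers S) d) (k : ℕ)

/-- `red_{p^k}` (finite coefficients `A_ρ[p^k]`) commutes with the relative corestriction `Cor : H¹(U, ·) → H¹(U', ·)`, `U ≤ U'` open of finite index
(`mapH1AddHom_coresLe`), read in the `subgroupRep (cofreeTorsionGaloisModule …).toTopRep` dialect (`discreteTopRep_cofreeTorsionBy_eq`, `rfl`).
[cite: Kato2004Asterisque, §13.8 (p. 228)] -/
theorem reduceH1CofreePkTorsion_coresLe {U U' : Subgroup (absoluteGaloisGroup ℚ)} (h : U ≤ U')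
    (hU : IsOpen (U : Set (absoluteGaloisGroup ℚ))) [hF : Fintype (U' ⧸ U.subgroupOf U')]
    (c : H1 (FramedGaloisRep.toGaloisRep ρ) U) :
    (reduceH1CofreePkTorsion S ρ k U' (coresLe (FramedGaloisRep.toGaloisRep ρ).toTopRep h hU c) :
        H1 (cofreeTorsionGaloisModule S ρ ((p ^ k : ℕ) : ℤ)) U') =
      coresLe (cofreeTorsionGaloisModule S ρ ((p ^ k : ℕ) : ℤ)).toTopRep h hU
        (reduceH1CofreePkTorsion S ρ k U c : H1 (cofreeTorsionGaloisModule S ρ ((p ^ k : ℕ) : ℤ)) U) :=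
  mapH1AddHom_coresLe (X := (FramedGaloisRep.toGaloisRep ρ).toTopRep) (Y := (cofreeTorsionGaloisModule S ρ ((p ^ k : ℕ) : ℤ)).toTopRep)
    (hF := hF) (divPowCofreeMkTorsion S ρ k) (continuous_divPowCofreeMkTorsion S ρ k) h hU
    (divPowCofreeMkTorsion_subgroupRep S ρ k U) (divPowCofreeMkTorsion_subgroupRep S ρ k U') c

/-- **`red_{p^k} ∘ cor = cor ∘ red_{p^k}`** for Kato's layer trace maps and the reduction `T_ρ → A_ρ[p^k]`, read in the
`H1 (cofreeTorsionGaloisModule …)` dialect of the layer pairings. [cite: Kato2004Asterisque, §12.2 (p. 220) and §13.8 (p. 228)] -/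
theorem reduceH1CofreePkTorsion_layerCores (κ : ZpExtension ℚ p) (n : ℕ) (c : H1 (FramedGaloisRep.toGaloisRep ρ) (κ.layerSubgroup (n + 1))) :
    (reduceH1CofreePkTorsion S ρ k (κ.layerSubgroup n) (layerCores (FramedGaloisRep.toGaloisRep ρ) κ n c) :
        H1 (cofreeTorsionGaloisModule S ρ ((p ^ k : ℕ) : ℤ)) (κ.layerSubgroup n)) =
      layerCores (cofreeTorsionGaloisModule S ρ ((p ^ k : ℕ) : ℤ)) κ n
        (reduceH1CofreePkTorsion S ρ k (κ.layerSubgroup (n + 1)) c : H1 (cofreeTorsionGaloisModule S ρ ((p ^ k : ℕ) : ℤ)) (κ.layerSubgroup (n + 1))) := by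
  unfold layerCores
  exact reduceH1CofreePkTorsion_coresLe S ρ k (hF := _) _ _ c

variable (W : WeierstrassCurve ℚ) {r : ℕ} (Θ : Cofree ρ ↥(padicCoeffField S) ≃+ (Fin r → ↥(W.geomPrimaryTorsion p))) (κ : ZpExtension ℚ p)
  (v : HeightOneSpectrum (𝓞 ℚ))
  (hΘ : ∀ (δ : absoluteGaloisGroup (v.adicCompletion ℚ)) (m : Cofree ρ ↥(padicCoeffField S)) (i : Fin r),
    Θ (resGalOfEmb (closureEmb (K := ℚ) (v.adicCompletion ℚ)) δ • m) i =
      resGalOfEmb (closureEmb (K := ℚ) (v.adicCompletion ℚ)) δ • Θ m i)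

/-- `res_{U_{n+1}}^{U_n} ∘ (thetaSingle i)_* = (thetaSingle i)_* ∘ res_{U_{n+1}}^{U_n}` (`mapH1AddHom_resLe`). [cite: SerreGaloisCohomology1997, I §2.2] -/
theorem resLe_thetaSingleH1 (i : Fin r) (n : ℕ) (c : continuousCohomology 1 (subgroupRep (torsionLocalRep W (p ^ k) v) (layerGroup κ v n))) :
    resLe (cofreeTorsionLocalRep S ρ ((p ^ k : ℕ) : ℤ) v) (SignedKatoOffTwo.LayerPairing.layerGroup_antitone κ v n) 1
        (thetaSingleH1 S ρ k W Θ κ v hΘ i n c) =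
      thetaSingleH1 S ρ k W Θ κ v hΘ i (n + 1)
        (resLe (torsionLocalRep W (p ^ k) v) (SignedKatoOffTwo.LayerPairing.layerGroup_antitone κ v n) 1 c) := by
  unfold thetaSingleH1
  exact (mapH1AddHom_resLe _ _ _ _ _ c).symm

variable [W.IsElliptic]

/-- `res_{U_{n+1}}^{U_n} κ_{U_n}(Q) = κ_{U_{n+1}}(Q)` for the Literature-dialect `CyclotomicLayer.layerKummer` — TP2's
`SignedKatoOffTwo.LayerPairing.resLe_layerKummer` read through the two dialects' parallel bodies. [cite: SilvermanAEC2009, X §4] -/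
theorem resLe_layerKummer' (N : ℕ) [NeZero N] (n : ℕ) (Q : localPoints W (v.adicCompletion ℚ))
    (hQ : Q ∈ localLayerPointsOfEmb κ (closureEmb (K := ℚ) (v.adicCompletion ℚ)) W n) :
    resLe (torsionLocalRep W N v) (SignedKatoOffTwo.LayerPairing.layerGroup_antitone κ v n) 1 (layerKummer W N κ v n ⟨Q, hQ⟩) =
      layerKummer W N κ v (n + 1)
        ⟨Q, Kobayashi2003.localLayerPointsOfEmb_mono κ (closureEmb (K := ℚ) (v.adicCompletion ℚ)) W (Nat.le_succ n) hQ⟩ :=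
  SignedKatoOffTwo.LayerPairing.resLe_layerKummer W N κ v n Q hQ

/-- **Restriction of the Θ-Kummer classes**: `res_{U_{n+1}}^{U_n} (thetaLayerKummer_n Q) = thetaLayerKummer_{n+1} Q` for `Q ∈ E(ℚ_{n,v})^r ⊆ E(ℚ_{n+1,v})^r`
(coordinatewise `resLe_layerKummer` of TP2 + `resLe_thetaSingleH1`). [cite: Kobayashi2003, §2 (p. 4)] [cite: SilvermanAEC2009, X §4] -/
theorem resLe_thetaLayerKummer (n : ℕ) (Q : Fin r → localPoints W (v.adicCompletion ℚ))
    (hQ : ∀ i, Q i ∈ localLayerPointsOfEmb κ (closureEmb (K := ℚ) (v.adicCompletion ℚ)) W n) :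
    haveI : NeZero (p ^ k) := ⟨pow_ne_zero k (Fact.out : p.Prime).ne_zero⟩
    resLe (cofreeTorsionLocalRep S ρ ((p ^ k : ℕ) : ℤ) v) (SignedKatoOffTwo.LayerPairing.layerGroup_antitone κ v n) 1
        (thetaLayerKummer S ρ k W Θ κ v hΘ n (fun i => ⟨Q i, hQ i⟩)) =
      thetaLayerKummer S ρ k W Θ κ v hΘ (n + 1)
        (fun i => ⟨Q i, Kobayashi2003.localLayerPointsOfEmb_mono κ (closureEmb (K := ℚ) (v.adicCompletion ℚ)) W (Nat.le_succ n) (hQ i)⟩) := by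
  haveI : NeZero (p ^ k) := ⟨pow_ne_zero k (Fact.out : p.Prime).ne_zero⟩
  rw [thetaLayerKummer_apply, thetaLayerKummer_apply, map_sum]
  refine Finset.sum_congr rfl fun i _ => ?_
  rw [resLe_thetaSingleH1, resLe_layerKummer' W κ v (p ^ k) n (Q i) (hQ i)]

variable (ePk : ∀ k : ℕ, ↥(AddSubgroup.torsionBy (Cofree ρ ↥(padicCoeffField S)) ((p ^ k : ℕ) : ℤ)) →
    ↥(AddSubgroup.torsionBy (Cofree ρ ↥(padicCoeffField S)) ((p ^ k : ℕ) : ℤ)) → AlgebraicClosure ℚ)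
  (hμPk : ∀ k a b, ePk k a b ^ (p ^ k) = 1)
  (hadd₁Pk : ∀ k a₁ a₂ b, ePk k (a₁ + a₂) b = ePk k a₁ b * ePk k a₂ b)
  (hadd₂Pk : ∀ k a b₁ b₂, ePk k a (b₁ + b₂) = ePk k a b₁ * ePk k a b₂)
  (hgalPk : ∀ k (σ : absoluteGaloisGroup ℚ) (a b : ↥(AddSubgroup.torsionBy (Cofree ρ ↥(padicCoeffField S)) ((p ^ k : ℕ) : ℤ))),
    σ • ePk k a b = ePk k (cofreeTorsionGaloisModule S ρ _ σ a) (cofreeTorsionGaloisModule S ρ _ σ b))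
  (hκ : κ.IsCyclotomic) (hv : (p : 𝓞 ℚ) ∈ v.asIdeal)

include hκ hv in
set_option maxHeartbeats 3200000 in
-- the dialect bridges `subgroupH1 U ↥A_ρ[p^k] = H1 (cofreeTorsionGaloisModule …) U` are slow to unify under `rw` (instance paths of the torsion subtype; as in p676533)
/-- **(P1) modulo `p^k` for the `ρ`-coefficient layer pairings**: `rhoLayerPairingPk n k (cor x) Q = rhoLayerPairingPk (n+1) k x Q` for
`Q ∈ E(ℚ_{n,v})^r` (`reduceH1CofreePkTorsion_layerCores`, generic (P1) `layerPairingOf_layerCores`, `resLe_thetaLayerKummer`) — the `ρ`-twin of TP2's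
`layerPairingPk_layerCores`. [cite: Kobayashi2003, (8.23) (p. 18)] [cite: Kato2004Asterisque, §12.2 (p. 220)] -/
theorem rhoLayerPairingPk_layerCores (n : ℕ) (x : H1 (FramedGaloisRep.toGaloisRep ρ) (κ.layerSubgroup (n + 1)))
    (Q : Fin r → localPoints W (v.adicCompletion ℚ))
    (hQ : ∀ i, Q i ∈ localLayerPointsOfEmb κ (closureEmb (K := ℚ) (v.adicCompletion ℚ)) W n) :
    rhoLayerPairingPk S ρ W ePk hμPk hadd₁Pk hadd₂Pk hgalPk Θ κ v hΘ n k (layerCores (FramedGaloisRep.toGaloisRep ρ) κ n x)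
        (fun i => ⟨Q i, hQ i⟩) =
      rhoLayerPairingPk S ρ W ePk hμPk hadd₁Pk hadd₂Pk hgalPk Θ κ v hΘ (n + 1) k x
        (fun i => ⟨Q i, Kobayashi2003.localLayerPointsOfEmb_mono κ (closureEmb (K := ℚ) (v.adicCompletion ℚ)) W (Nat.le_succ n) (hQ i)⟩) := by
  haveI : NeZero (p ^ k) := ⟨pow_ne_zero k (Fact.out : p.Prime).ne_zero⟩
  rw [rhoLayerPairingPk_apply, rhoLayerPairingPk_apply, ← layerPairingOf_apply, ← layerPairingOf_apply]
  change layerPairingOf _ (p ^ k) (ePk k) (hμPk k) (hadd₁Pk k) (hadd₂Pk k) (hgalPk k) κ v n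
      (reduceH1CofreePkTorsion S ρ k (κ.layerSubgroup n) (layerCores (FramedGaloisRep.toGaloisRep ρ) κ n x) :
        H1 (cofreeTorsionGaloisModule S ρ ((p ^ k : ℕ) : ℤ)) (κ.layerSubgroup n))
      (thetaLayerKummer S ρ k W Θ κ v hΘ n fun i => ⟨Q i, hQ i⟩) =
    layerPairingOf _ (p ^ k) (ePk k) (hμPk k) (hadd₁Pk k) (hadd₂Pk k) (hgalPk k) κ v (n + 1)
      (reduceH1CofreePkTorsion S ρ k (κ.layerSubgroup (n + 1)) x : H1 (cofreeTorsionGaloisModule S ρ ((p ^ k : ℕ) : ℤ)) (κ.layerSubgroup (n + 1)))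
      (thetaLayerKummer S ρ k W Θ κ v hΘ (n + 1) fun i =>
        ⟨Q i, Kobayashi2003.localLayerPointsOfEmb_mono κ (closureEmb (K := ℚ) (v.adicCompletion ℚ)) W (Nat.le_succ n) (hQ i)⟩)
  rw [reduceH1CofreePkTorsion_layerCores, layerPairingOf_layerCores _ (p ^ k) (ePk k) (hμPk k) (hadd₁Pk k) (hadd₂Pk k) (hgalPk k) κ v hκ hv,
    resLe_thetaLayerKummer]

include hκ hv in
/-- **(P1) for THE pinned `ℤ_p`-valued family**: `rhoLayerPairingAdic n (cor x) Q = rhoLayerPairingAdic (n+1) x Q` for `Q ∈ E(ℚ_{n,v})^r` (residue-wise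
from `rhoLayerPairingPk_layerCores`, `PadicInt.ext_of_toZModPow`). [cite: PerrinRiou1994Invent, §3.6.1] [cite: Kato2004Asterisque, §12.2 (p. 220)] -/
theorem rhoLayerPairingAdic_layerCores
    (hcompat : ∀ (n k : ℕ) (x : H1 (FramedGaloisRep.toGaloisRep ρ) (κ.layerSubgroup n))
      (Q : Fin r → localLayerPointsOfEmb κ (closureEmb (K := ℚ) (v.adicCompletion ℚ)) W n),
      (ZMod.cast (rhoLayerPairingPk S ρ W ePk hμPk hadd₁Pk hadd₂Pk hgalPk Θ κ v hΘ n (k + 1) x Q) : ZMod (p ^ k)) =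
        rhoLayerPairingPk S ρ W ePk hμPk hadd₁Pk hadd₂Pk hgalPk Θ κ v hΘ n k x Q)
    (n : ℕ) (x : H1 (FramedGaloisRep.toGaloisRep ρ) (κ.layerSubgroup (n + 1)))
    (Q : Fin r → localPoints W (v.adicCompletion ℚ))
    (hQ : ∀ i, Q i ∈ localLayerPointsOfEmb κ (closureEmb (K := ℚ) (v.adicCompletion ℚ)) W n) :
    rhoLayerPairingAdic S ρ W ePk hμPk hadd₁Pk hadd₂Pk hgalPk Θ κ v hΘ n (hcompat n) (layerCores (FramedGaloisRep.toGaloisRep ρ) κ n x)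
        (fun i => ⟨Q i, hQ i⟩) =
      rhoLayerPairingAdic S ρ W ePk hμPk hadd₁Pk hadd₂Pk hgalPk Θ κ v hΘ (n + 1) (hcompat (n + 1)) x
        (fun i => ⟨Q i, Kobayashi2003.localLayerPointsOfEmb_mono κ (closureEmb (K := ℚ) (v.adicCompletion ℚ)) W (Nat.le_succ n) (hQ i)⟩) := by
  refine PadicInt.ext_of_toZModPow.mp fun k => ?_
  rw [toZModPow_rhoLayerPairingAdic, toZModPow_rhoLayerPairingAdic,
    rhoLayerPairingPk_layerCores S ρ k W Θ κ v hΘ ePk hμPk hadd₁Pk hadd₂Pk hgalPk hκ hv n x Q hQ]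

end Rho

/-! ## §3 The glue over the tower: `locd₂ : 𝐇¹_Γ(T_ρ) →+ Hom((Fin r → E(ℚ_{∞,v})), ℤ_p)` -/

section Glue

variable {p : ℕ} [Fact p.Prime] {A : Type} [CommRing A] [TopologicalSpace A] {M : Type} [AddCommGroup M] [Module A M]
  [TopologicalSpace M] [IsTopologicalAddGroup M] [ContinuousSMul A M] {T : GaloisRep ℚ A M}
  {κ : ZpExtension ℚ p} {γ : absoluteGaloisGroup ℚ} (I : IwasawaH1DataCoeff T p κ γ)
  (W : WeierstrassCurve ℚ) (v : HeightOneSpectrum (𝓞 ℚ)) {r : ℕ}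
  (pair : ∀ n : ℕ, H1 T (κ.layerSubgroup n) →+
    ((Fin r → localLayerPointsOfEmb κ (closureEmb (K := ℚ) (v.adicCompletion ℚ)) W n) →+ ℤ_[p]))
  (hP1 : ∀ (n : ℕ) (x : H1 T (κ.layerSubgroup (n + 1))) (Q : Fin r → localPoints W (v.adicCompletion ℚ))
    (hQ : ∀ i, Q i ∈ localLayerPointsOfEmb κ (closureEmb (K := ℚ) (v.adicCompletion ℚ)) W n),
    pair n (layerCores T κ n x) (fun i => ⟨Q i, hQ i⟩) =
      pair (n + 1) x (fun i => ⟨Q i, Kobayashi2003.localLayerPointsOfEmb_mono κ (closureEmb (K := ℚ) (v.adicCompletion ℚ)) W (Nat.le_succ n) (hQ i)⟩))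

include hP1 in
/-- **Level independence, `m ≤ n`** under (P1): `pair m (proj m x) Q = pair n (proj n x) Q` for a tuple `Q` of points of layer `m`
(`I.cores_proj`). [cite: Kato2004Asterisque, §12.2 (p. 220)] [cite: PerrinRiou1994Invent, §3.6.1] -/
theorem pair_proj_eq_of_le (x : I.H) {m n : ℕ} (hmn : m ≤ n) (Q : Fin r → localPoints W (v.adicCompletion ℚ))
    (hQm : ∀ i, Q i ∈ localLayerPointsOfEmb κ (closureEmb (K := ℚ) (v.adicCompletion ℚ)) W m)
    (hQn : ∀ i, Q i ∈ localLayerPointsOfEmb κ (closureEmb (K := ℚ) (v.adicCompletion ℚ)) W n) :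
    pair m (I.proj m x) (fun i => ⟨Q i, hQm i⟩) = pair n (I.proj n x) (fun i => ⟨Q i, hQn i⟩) := by
  induction n, hmn using Nat.le_induction with
  | base => rfl
  | succ n hmn ih =>
    rw [ih (fun i => Kobayashi2003.localLayerPointsOfEmb_mono κ _ W hmn (hQm i)), ← I.cores_proj n x, hP1 n (I.proj (n + 1) x) Q]

include hP1 in
/-- **Level independence** (any two layers containing the tuple). [cite: Kato2004Asterisque, §12.2 (p. 220)] -/
theorem pair_proj_eq (x : I.H) {m n : ℕ} (Q : Fin r → localPoints W (v.adicCompletion ℚ))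
    (hQm : ∀ i, Q i ∈ localLayerPointsOfEmb κ (closureEmb (K := ℚ) (v.adicCompletion ℚ)) W m)
    (hQn : ∀ i, Q i ∈ localLayerPointsOfEmb κ (closureEmb (K := ℚ) (v.adicCompletion ℚ)) W n) :
    pair m (I.proj m x) (fun i => ⟨Q i, hQm i⟩) = pair n (I.proj n x) (fun i => ⟨Q i, hQn i⟩) := by
  rcases le_total m n with h | h
  · exact pair_proj_eq_of_le I W v pair hP1 x h Q hQm hQn
  · exact (pair_proj_eq_of_le I W v pair hP1 x h Q hQn hQm).symm

/-- A common layer for a tuple of tower points: every `Q_i ∈ E(ℚ_{∞,v})` lies in the layer `N = max_i level(Q_i)`. [cite: Sprung2012, §2 (p. 1486)] -/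
theorem exists_common_layer (Q : Fin r → localTowerPointsOfEmb κ (closureEmb (K := ℚ) (v.adicCompletion ℚ)) W) :
    ∃ N : ℕ, ∀ i, ((Q i : localPoints W (v.adicCompletion ℚ))) ∈ localLayerPointsOfEmb κ (closureEmb (K := ℚ) (v.adicCompletion ℚ)) W N := by
  refine ⟨Finset.univ.sup fun i => level κ (closureEmb (K := ℚ) (v.adicCompletion ℚ)) W (Q i), fun i => ?_⟩
  exact Kobayashi2003.localLayerPointsOfEmb_mono κ _ W (Finset.le_sup (f := fun i => level κ (closureEmb (K := ℚ) (v.adicCompletion ℚ)) W (Q i))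
    (Finset.mem_univ i)) (mem_layer_level κ _ W (Q i))

include hP1 in
/-- **K-c: the glue `locd₂`.** Under (P1), the layer pairings of the projections of `x ∈ 𝐇¹_Γ(T)` glue to ONE additive functional on tuples of tower
points `(Fin r → E(ℚ_{∞,v}))`, additively in `x`: `∃ locd₂ : I.H →+ ((Fin r → E(ℚ_{∞,v})) →+ ℤ_p)` with the LAYER FORMULA
`locd₂ x Q = pair n (proj n x) Q` whenever every `Q_i ∈ E(ℚ_{n,v})` (value := pairing at a common layer of the tuple; independent of the layer
by `pair_proj_eq`; additive in `Q` through a common layer of `Q, Q'`). The `ρ`/tuple twin of TP2's `SignedKatoOffTwo.ColGlue.exists_col`.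
[cite: Kato2004Asterisque, §12.2 (p. 220), §17.13 (p. 279)] [cite: Sprung2012, Lemma 7.10 (p. 1503)] [cite: PerrinRiou1994Invent, §3.6.1] -/
theorem exists_locd₂_of_layerCores :
    ∃ locd₂ : I.H →+ ((Fin r → localTowerPointsOfEmb κ (closureEmb (K := ℚ) (v.adicCompletion ℚ)) W) →+ ℤ_[p]),
      ∀ (n : ℕ) (x : I.H) (Q : Fin r → localPoints W (v.adicCompletion ℚ))
        (hQ : ∀ i, Q i ∈ localLayerPointsOfEmb κ (closureEmb (K := ℚ) (v.adicCompletion ℚ)) W n),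
        locd₂ x (fun i => ⟨Q i, localLayerPointsOfEmb_le_localTowerPointsOfEmb κ _ W n (hQ i)⟩) = pair n (I.proj n x) (fun i => ⟨Q i, hQ i⟩) := by
  -- a chosen common layer `N Q` of each tuple, and the value there
  have hN := fun Q : Fin r → localTowerPointsOfEmb κ (closureEmb (K := ℚ) (v.adicCompletion ℚ)) W => exists_common_layer W v Q
  choose N hN using hN
  have key : ∀ (x : I.H) (Q : Fin r → localTowerPointsOfEmb κ (closureEmb (K := ℚ) (v.adicCompletion ℚ)) W) (n : ℕ)
      (hQ : ∀ i, ((Q i : localPoints W (v.adicCompletion ℚ))) ∈ localLayerPointsOfEmb κ (closureEmb (K := ℚ) (v.adicCompletion ℚ)) W n),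
      pair (N Q) (I.proj (N Q) x) (fun i => ⟨Q i, hN Q i⟩) = pair n (I.proj n x) (fun i => ⟨Q i, hQ i⟩) :=
    fun x Q n hQ => pair_proj_eq I W v pair hP1 x (fun i => (Q i : localPoints W (v.adicCompletion ℚ))) (hN Q) hQ
  let colx : I.H → ((Fin r → localTowerPointsOfEmb κ (closureEmb (K := ℚ) (v.adicCompletion ℚ)) W) →+ ℤ_[p]) := fun x =>
    { toFun := fun Q => pair (N Q) (I.proj (N Q) x) (fun i => ⟨Q i, hN Q i⟩)
      map_zero' := by
        rw [key x 0 0 (fun i => (localLayerPointsOfEmb κ _ W 0).zero_mem)]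
        exact (pair 0 (I.proj 0 x)).map_zero
      map_add' := fun Q Q' => by
        obtain ⟨N₁, h₁⟩ := exists_common_layer W v Q
        obtain ⟨N₂, h₂⟩ := exists_common_layer W v Q'
        have hy : ∀ i, ((Q i : localPoints W (v.adicCompletion ℚ))) ∈ localLayerPointsOfEmb κ (closureEmb (K := ℚ) (v.adicCompletion ℚ)) W (max N₁ N₂) :=
          fun i => Kobayashi2003.localLayerPointsOfEmb_mono κ _ W (le_max_left N₁ N₂) (h₁ i)
        have hy' : ∀ i, ((Q' i : localPoints W (v.adicCompletion ℚ))) ∈ localLayerPointsOfEmb κ (closureEmb (K := ℚ) (v.adicCompletion ℚ)) W (max N₁ N₂) :=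
          fun i => Kobayashi2003.localLayerPointsOfEmb_mono κ _ W (le_max_right N₁ N₂) (h₂ i)
        have hyy' : ∀ i, (((Q + Q') i : localPoints W (v.adicCompletion ℚ))) ∈
            localLayerPointsOfEmb κ (closureEmb (K := ℚ) (v.adicCompletion ℚ)) W (max N₁ N₂) := fun i => add_mem (hy i) (hy' i)
        rw [key x Q _ hy, key x Q' _ hy', key x (Q + Q') _ hyy']
        exact (pair (max N₁ N₂) (I.proj (max N₁ N₂) x)).map_add (fun i => ⟨Q i, hy i⟩) (fun i => ⟨Q' i, hy' i⟩) }
  have hcolx : ∀ (x : I.H) (Q : Fin r → localTowerPointsOfEmb κ (closureEmb (K := ℚ) (v.adicCompletion ℚ)) W),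
      colx x Q = pair (N Q) (I.proj (N Q) x) (fun i => ⟨Q i, hN Q i⟩) := fun _ _ => rfl
  refine ⟨{ toFun := colx, map_zero' := ?_, map_add' := fun x x' => ?_ }, fun n x Q hQ => ?_⟩
  · exact AddMonoidHom.ext fun Q => by
      rw [hcolx, map_zero, map_zero, AddMonoidHom.zero_apply, AddMonoidHom.zero_apply]
  · exact AddMonoidHom.ext fun Q => by
      rw [AddMonoidHom.add_apply, hcolx, hcolx, hcolx, map_add, map_add, AddMonoidHom.add_apply]
  · exact key x (fun i => ⟨Q i, localLayerPointsOfEmb_le_localTowerPointsOfEmb κ _ W n (hQ i)⟩) n hQ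

/-- **Uniqueness of the glue**: two additive `𝐇¹ → Hom((Fin r → E_∞), ℤ_p)` with the layer formula agree (every tuple lies in a common layer).
[cite: Sprung2012, Lemma 7.10 (p. 1503)] -/
theorem locd₂_unique {locd₂ locd₂' : I.H →+ ((Fin r → localTowerPointsOfEmb κ (closureEmb (K := ℚ) (v.adicCompletion ℚ)) W) →+ ℤ_[p])}
    (h : ∀ (n : ℕ) (x : I.H) (Q : Fin r → localPoints W (v.adicCompletion ℚ))
      (hQ : ∀ i, Q i ∈ localLayerPointsOfEmb κ (closureEmb (K := ℚ) (v.adicCompletion ℚ)) W n),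
      locd₂ x (fun i => ⟨Q i, localLayerPointsOfEmb_le_localTowerPointsOfEmb κ _ W n (hQ i)⟩) = pair n (I.proj n x) (fun i => ⟨Q i, hQ i⟩))
    (h' : ∀ (n : ℕ) (x : I.H) (Q : Fin r → localPoints W (v.adicCompletion ℚ))
      (hQ : ∀ i, Q i ∈ localLayerPointsOfEmb κ (closureEmb (K := ℚ) (v.adicCompletion ℚ)) W n),
      locd₂' x (fun i => ⟨Q i, localLayerPointsOfEmb_le_localTowerPointsOfEmb κ _ W n (hQ i)⟩) = pair n (I.proj n x) (fun i => ⟨Q i, hQ i⟩)) :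
    locd₂ = locd₂' := by
  refine AddMonoidHom.ext fun x => AddMonoidHom.ext fun Q => ?_
  obtain ⟨n, hn⟩ := exists_common_layer W v Q
  have e : Q = fun i => ⟨(Q i : localPoints W (v.adicCompletion ℚ)), localLayerPointsOfEmb_le_localTowerPointsOfEmb κ _ W n (hn i)⟩ :=
    funext fun i => Subtype.ext rfl
  rw [e, h n x _ hn, h' n x _ hn]

end Glue

end Summit.BirchSwinnertonDyer.BirchSwinnertonDyer.Theorems.ThetaTransport

end
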